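import Summits.BirchSwinnertonDyer.BirchSwinnertonDyer.Theorems.QuadraticBranchSignedControlPlusEtaKuriharaRecordsLocalTorsion01
import Summits.BirchSwinnertonDyer.BirchSwinnertonDyer.Theses.QuadraticBranchSignedControl
import Summits.BirchSwinnertonDyer.Rank1Residual.GaloisImage.JWitnessTowerSurjectivity
import Summits.BirchSwinnertonDyer.Rank1Residual.Additive.GordRankZeroChiBranch
import HarnessLib

/-!
# Route `QuadraticBranchSignedControl` (rung K8, cell `bsd-potss`), crux `PlusEtaLowerInclusion`
# (item stmt-BirchSwinnertonDyer-19601): THE KURIHARA CUT — the crux BY NAME from Kim's Thm. 1.11 at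
# `η`, ONE admissible parametrisation datum with a UNIT KURIHARA NUMBER on every Tamagawa-`p`-free
# tower-onto partner, and the Tamagawa rows (a `--supports` file; seat `bsd-potss-k8eta-c1`, gen 8)

HONEST FRAMING (cell `bsd-potss`, run/shared/lean/pub/bsd-potss/; FULL-BSD rank ≤ 1 programme,
tranche 1b, HUMAN RULING D-0036/D-0074; verbatim in every file): the target of record is FULL BSD for
every analytic-rank ≤ 1 curve over `ℚ`; this cell attacks rows B4/B5/B8 (additive potentially
supersingular primes). Crux 19601 `PlusEtaLowerInclusion` — Kobayashi's Eisenstein (lower) inclusion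
of the even main conjecture at `η = ω^{(p−1)/2}`, `Char(X⁺(V/K_∞)^η) ⊆ (L_p⁺(V, η, X))`, for every
good supersingular `a_p(V) = 0` twist `V/ℚ`, `p ≥ 5`, whose `p`-adic tower is onto = Kato's lower IMC
inclusion for the ADDITIVE partner `W = V ⊗ χ_{p*}` — is OPEN class-wide and in print for no non-CM `V`.
THIS FILE closes nothing, books nothing and claims `BSD(W, p)` for no pair.

WHAT. Gens 6–7 of this seat built the KURIHARA ROAD per pair
(`PlusEtaKuriharaT0.etaPair_of_thm111_of_kuriharaUnit`: the named fact
`Kim2026.thm111_etaEisensteinInclusion_of_kuriharaNumber_ne_zero` + ONE globally minimal partner `W`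
of `V` with `ρ̄_{W,p}` onto, `p ∤ ∏ c_ℓ(W)`, a modular parametrisation datum `D` with `p ∤ c_D` and
`p`-unit period transfer, and ONE unit Kurihara number `δ̃_n(D.f) ≠ 0` at a cyclic `𝒩₁`-level ⟹
(E⁺_η) at `(V, p)`; the local binder `#W(ℚ_p)[p] = 1` is a theorem since gen 7) and instantiated it on
39 of the 40 tower-onto census rows; the reading handed to the planner in prose (gen 6 memo §D (a),
gen 7 memo §D) was: «on the Tamagawa-`p`-free tower-onto sub-locus, 19601 ⟸ Kurihara's conjecture
mod `p` for the partner (Kim 2026 Conj. 1.9, a Σ₁ statement per pair); the Tamagawa rows are a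
different statement (Λ-primitivity of `κ^{Kato,∞}(W)`, Kim Thm. 1.4)». THIS FILE makes that reading a
KERNEL THEOREM concluding the crux BY NAME (`PlusEtaLowerInclusion`, the route decl), cut by the
road's own hypothesis `p ∣ ∏ c_ℓ(W)` rather than by the Fouquet–Wan sub-locus of the registered
skeleton v4 (`stub_etaLower_fwLocus` / `stub_etaLower_offLocus`):

* §1 `exists_minimalPartner_of_tower` — for every elliptic `V/ℚ` and odd-or-even prime `p` there is a
  GLOBALLY MINIMAL partner `W` and a change of variables `C` over `ℚ` with `C • W^{(p*)} = V`,
  `p* = (−1)^{⌊p/2⌋} p`, and `ρ̄_{W,p^m}` is onto iff `ρ̄_{V,p^m}` is, for every `m` (minimal model of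
  `V^{(p*)}` + the twist involution on models + twist/model invariance of level-`p^m` surjectivity —
  tree `AdditivePotMult.exists_globallyMinimal_model_twist`,
  `Additive.exists_variableChange_twist_of_model_twist`,
  `GaloisImage.hasSurjectiveModNGaloisRep_pow_iff_of_model_twist`);
* §2 `plusEtaLowerInclusion_of_kim111_of_kuriharaData_of_tamagawaRows` — **THE KURIHARA CUT**:
  `PlusEtaLowerInclusion` follows from (K1) the named fact Kim 1.11η, (K2) «every Tamagawa-`p`-free
  tower-onto Gss2 partner `W` (`p ≥ 5`) carries an admissible parametrisation datum (`p ∤ c_D`,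
  `p`-unit period transfer) AND a unit Kurihara number at a cyclic `𝒩₁`-level» — Manin's `c = ±1`
  input and Kurihara's conjecture mod `p` (Kim Conj. 1.9) in ONE Σ₁ statement per pair —, (K3) (E⁺_η)
  on the pairs with `p ∣ ∏ c_ℓ(W)`; proof = §1 + `by_cases p ∣ ∏ c_ℓ(W)` + the road;
* §3 `plusEtaLowerInclusion_of_kim111_of_maninUnit_of_kuriharaUnit_of_tamagawaRows` — the same with
  (K2) SPLIT into (K2a) the Manin/period datum for every tower-onto partner and (K2b) a unit Kurihara
  number for EVERY parametrisation datum of a Tamagawa-free partner (Kurihara's conjecture verbatim);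
* §4 `etaPair_of_kim111_of_kuriharaData` — the per-`V` form on the Tamagawa-free sub-locus: (E⁺_η) AND,
  the tower being onto, the full even main conjecture (C1⁺_η) at `(V, p)` from (K1) + (K2) alone (no
  partner in the statement: §1 supplies it).

EVIDENCE behind (K2) (item 19601, this seat gens 2/6/7; numbers, not adjectives): unit `ν = 1` Kurihara
numbers on EVERY computed Tamagawa-free rank-one Gss2 partner at `p = 5` (2044/2044, `N_W ≤ 425550`)
and `p = 7` (988/988, `N_W ≤ 254310`), within the first five Kolyvagin primes, two engines on the
record rows; rank-zero Tamagawa-free census rows 16/16 (kit j260432/j261654); Tamagawa rows: 0/230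
units (Kim Remark 6.2 — (K2) is FALSE there by design, whence the cut). Cremona: `c = 1` for every
optimal curve of conductor `< 500000`.

HONEST LABEL: a CONDITIONAL closer (three displayed hypotheses, the first a named Literature fact
read at `η` through the flagged zeta-line identification); (K2) restricted to optimal partners is
Manin's conjecture + Kurihara's conjecture, both OPEN class-wide; (K3) is Kato's lower inclusion on the
Tamagawa rows, OPEN, no finite certificate known (Kim Thm. 1.4: Λ-primitivity of `κ^{Kato,∞}(W)`).
Nothing is booked; the registered skeleton v4 (sha `f52b9fac6fa9`) is untouched by this file (a v5
candidate carrying this cut is offered to the planner separately). BSD is not proved by any of this.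

References: [Kim2022StructureSelmer] Thm. 1.11 (PDF p. 8), Conj. 1.9, Thm. 1.4, Remark 6.2, §1.3.5;
[Kobayashi2003] §4 Even main conjecture (p. 8), proof of Thm. 7.4 (p. 13); [Kato2004Asterisque]
Conj. 12.10; [SilvermanAEC2009] VIII.8 Cor. 8.3, X.5 Cor. 5.4; [CesnaviciusNeururerSaha2023] §1
(Cremona's Manin data).
-/

set_option autoImplicit false
-- sibling precedent (`…PlusEtaKuriharaRecordsLocalTorsion01.lean`): the directory name repeats the summit name
set_option linter.dupNamespace false

noncomputable section

open scoped Classical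

namespace Summit.BirchSwinnertonDyer.BirchSwinnertonDyer.Theorems.PlusEtaKuriharaCut

open CongruenceSubgroup WeierstrassCurve Field Literature.NumberTheory.EllipticCurves
  Literature.NumberTheory.EllipticCurves.ModularForms
  Literature.NumberTheory.GaloisRepresentations
  Literature.NumberTheory.EllipticCurves.Rank1Residual
  Literature.NumberTheory.EllipticCurves.Rank1Residual.Typed
  Summit.BirchSwinnertonDyer.Rank1Residual
  Summit.BirchSwinnertonDyer.BirchSwinnertonDyer.Theorems
  Summit.BirchSwinnertonDyer.BirchSwinnertonDyer.Theses.QuadraticBranchSignedControl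

open Summit.BirchSwinnertonDyer.Rank1Residual.Additive hiding EtaSignedSelmerDualData
  IsQuadraticBranchPlusLFunction IsQuadraticBranchMinusLFunction

/-! ## §1 The globally minimal partner of a twist and its tower -/

/-- **The globally minimal partner of `V` along `p*`.** For every elliptic `V/ℚ` and prime `p` there
are a GLOBALLY MINIMAL elliptic `W/ℚ` and a change of variables `C` over `ℚ` with
`C • W^{(p*)} = V` (`p* = (−1)^{⌊p/2⌋} p`) — `W` a minimal model of `V^{(p*)}` (Silverman VIII.8.3,
tree `AdditivePotMult.exists_globallyMinimal_model_twist`) turned round by the twist involution on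
models (`Additive.exists_variableChange_twist_of_model_twist`) — and, for every `m`, `ρ̄_{W,p^m}` is
onto iff `ρ̄_{V,p^m}` is (`GaloisImage.hasSurjectiveModNGaloisRep_pow_iff_of_model_twist`).
[cite: SilvermanAEC2009, VIII.8 Cor. 8.3 and X.5 Cor. 5.4] -/
theorem exists_minimalPartner_of_tower (V : WeierstrassCurve ℚ) [V.IsElliptic] (p : ℕ)
    [Fact p.Prime] :
    ∃ (W : WeierstrassCurve ℚ) (_ : W.IsElliptic) (_ : W.IsGloballyMinimal) (C : VariableChange ℚ),
      C • W.quadraticTwist ((-1) ^ (p / 2) * p) = V ∧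
        ∀ m : ℕ, W.HasSurjectiveModNGaloisRep (p ^ m : ℕ) ↔ V.HasSurjectiveModNGaloisRep (p ^ m : ℕ) := by
  have hd : ((-1 : ℚ) ^ (p / 2) * p) ≠ 0 :=
    mul_ne_zero (pow_ne_zero _ (by norm_num)) (by exact_mod_cast (Fact.out : p.Prime).ne_zero)
  obtain ⟨W, iW, iWm, C', hC'⟩ := AdditivePotMult.exists_globallyMinimal_model_twist V hd
  obtain ⟨C, hCV⟩ := exists_variableChange_twist_of_model_twist V hd hC'
  exact ⟨W, iW, iWm, C, hCV, fun m ↦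
    GaloisImage.hasSurjectiveModNGaloisRep_pow_iff_of_model_twist V p hd ⟨C', hC'⟩ m⟩

/-! ## §2 The Kurihara cut of the crux (merged Σ₁ datum per Tamagawa-free partner) -/

/-- **THE KURIHARA CUT OF CRUX 19601.** `PlusEtaLowerInclusion` — (E⁺_η) for every tower-onto good
supersingular `a_p = 0` twist `V`, `p ≥ 5` — follows from
(K1) `hKim` : Kim 2026 Thm. 1.11 (1) ⟹ (3) read at `η` (named fact, hypothesis position);
(K2) `hKur` : for every globally minimal partner `W` (`C • W^{(p*)} = V`) of such a pair with
  `p ∤ ∏ c_ℓ(W)`: SOME modular parametrisation datum `D` of `W` with `p ∤ c_D` and a `p`-unit period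
  transfer `Ω(W) = u · Ω⁺_{D.f}`, and SOME level `n ∈ 𝒩₁(W, p)` with `#W̃(𝔽_ℓ)[p] ≤ p` for `ℓ ∣ n`,
  surjective characters `ψ_ℓ : 𝔽_ℓ^× ↠ ℤ/p` and `δ̃_n(D.f, ψ) ≠ 0` — Manin's input and Kurihara's
  conjecture mod `p` (Kim Conj. 1.9) as ONE Σ₁ statement per pair;
(K3) `hTam` : (E⁺_η) at every such pair with `p ∣ ∏ c_ℓ(W)` (the Tamagawa rows).
Proof: §1 gives the minimal partner and `ρ̄_{W,p}` onto from the tower at `m = 1`; split on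
`p ∣ ∏ c_ℓ(W)`; on the Tamagawa-free side the road
`PlusEtaKuriharaT0.etaPair_of_thm111_of_kuriharaUnit` (local binder already discharged there).
CONDITIONAL (three displayed hypotheses); closes nothing by itself; nothing booked.
[cite: Kim2022StructureSelmer, Thm. 1.11 (PDF p. 8), Conj. 1.9, Remark 6.2]
[cite: Kobayashi2003, §4 Even main conjecture (p. 8), proof of Thm. 7.4 (p. 13)] -/
theorem plusEtaLowerInclusion_of_kim111_of_kuriharaData_of_tamagawaRows
    (hKim : Kim2026.thm111_etaEisensteinInclusion_of_kuriharaNumber_ne_zero)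
    (hKur : ∀ (V : WeierstrassCurve ℚ) [V.IsElliptic] [V.IsGloballyMinimal] (W : WeierstrassCurve ℚ)
      [W.IsElliptic] [W.IsGloballyMinimal] (C : VariableChange ℚ) (p : ℕ) [Fact p.Prime],
      5 ≤ p → C • W.quadraticTwist ((-1) ^ (p / 2) * p) = V → V.HasGoodReductionAtPrime p →
      V.frobeniusTrace p = 0 → (∀ m : ℕ, V.HasSurjectiveModNGaloisRep (p ^ m : ℕ)) →
      ¬ p ∣ W.tamagawaProduct →
      ∃ (NW : ℕ) (_ : NeZero NW) (D : ModularParametrizationData W NW),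
        ¬ (p : ℤ) ∣ D.maninConstant ∧
        (∃ u : ℚ, ‖(u : ℚ_[p])‖ = 1 ∧ W.realPeriodRat = u * plusPeriod D.f) ∧
        ∃ (n : ℕ) (_ : NeZero n), Kato.IsKolyvaginProduct W p 1 n ∧
          (∀ (ℓ : ℕ) [Fact ℓ.Prime], ℓ ∣ n →
            Nat.card {P : ((WeierstrassCurve.integralModelInt W).map
              (Int.castRingHom (ZMod ℓ))).toAffine.Point // p • P = 0} ≤ p) ∧
          ∃ ψ : (ℓ : ℕ) → (ZMod ℓ)ˣ →* Multiplicative (ZMod p),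
            (∀ ℓ ∈ n.primeFactors, Function.Surjective (ψ ℓ)) ∧ kuriharaNumber D.f p n ψ ≠ 0)
    (hTam : ∀ (V : WeierstrassCurve ℚ) [V.IsElliptic] [V.IsGloballyMinimal] (W : WeierstrassCurve ℚ)
      [W.IsElliptic] [W.IsGloballyMinimal] (C : VariableChange ℚ) (p : ℕ) [Fact p.Prime],
      5 ≤ p → C • W.quadraticTwist ((-1) ^ (p / 2) * p) = V → V.HasGoodReductionAtPrime p →
      V.frobeniusTrace p = 0 → (∀ m : ℕ, V.HasSurjectiveModNGaloisRep (p ^ m : ℕ)) →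
      p ∣ W.tamagawaProduct → QuadraticBranchPlusEtaLowerInclusionAt V p) :
    PlusEtaLowerInclusion := by
  intro V _ _ p _ h5 hgood hap htower
  obtain ⟨W, _, _, C, hCV, hsurjW⟩ := exists_minimalPartner_of_tower V p
  by_cases htam : p ∣ W.tamagawaProduct
  · exact hTam V W C p h5 hCV hgood hap htower htam
  · have hsurj : W.HasSurjectiveModNGaloisRep p := by
      simpa only [pow_one] using (hsurjW 1).mpr (htower 1)
    obtain ⟨NW, _, D, hc, hper, n, _, hn, hcyc, ψ, hψ, hδ⟩ :=
      hKur V W C p h5 hCV hgood hap htower htam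
    exact (PlusEtaKuriharaT0.etaPair_of_thm111_of_kuriharaUnit hKim W C hCV h5 hsurj htam D hc hper
      n hn hcyc ψ hψ hδ).1

/-! ## §3 The same cut with the Manin datum and Kurihara's conjecture SPLIT -/

/-- **The Kurihara cut, split form.** As §2 with (K2) split into
(K2a) `hManin` : every tower-onto Gss2 partner `W` (`p ≥ 5`) carries a modular parametrisation datum
  `D` with `p ∤ c_D` and a `p`-unit period transfer (for an OPTIMAL `W` this is Manin's `c = ±1` —
  Cremona for `N < 500000`, open beyond at a prime of additive reduction) and
(K2b) `hKur` : for EVERY parametrisation datum `D` of a Tamagawa-`p`-free tower-onto partner there is a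
  cyclic `𝒩₁`-level with a unit Kurihara number of `D.f` — Kurihara's conjecture mod `p` verbatim
  (Kim 2026 Conj. 1.9; witnessed on 3032/3032 Tamagawa-free rank-one partners at `p ∈ {5, 7}` and
  16/16 rank-zero census rows).
CONDITIONAL; closes nothing by itself; nothing booked.
[cite: Kim2022StructureSelmer, Conj. 1.9, Thm. 1.11 (PDF p. 8), §1.3.5]
[cite: CesnaviciusNeururerSaha2023, §1 (Cremona's Manin data)] -/
theorem plusEtaLowerInclusion_of_kim111_of_maninUnit_of_kuriharaUnit_of_tamagawaRows
    (hKim : Kim2026.thm111_etaEisensteinInclusion_of_kuriharaNumber_ne_zero)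
    (hManin : ∀ (V : WeierstrassCurve ℚ) [V.IsElliptic] [V.IsGloballyMinimal] (W : WeierstrassCurve ℚ)
      [W.IsElliptic] [W.IsGloballyMinimal] (C : VariableChange ℚ) (p : ℕ) [Fact p.Prime],
      5 ≤ p → C • W.quadraticTwist ((-1) ^ (p / 2) * p) = V → V.HasGoodReductionAtPrime p →
      V.frobeniusTrace p = 0 → (∀ m : ℕ, V.HasSurjectiveModNGaloisRep (p ^ m : ℕ)) →
      ∃ (NW : ℕ) (_ : NeZero NW) (D : ModularParametrizationData W NW),
        ¬ (p : ℤ) ∣ D.maninConstant ∧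
        ∃ u : ℚ, ‖(u : ℚ_[p])‖ = 1 ∧ W.realPeriodRat = u * plusPeriod D.f)
    (hKur : ∀ (V : WeierstrassCurve ℚ) [V.IsElliptic] [V.IsGloballyMinimal] (W : WeierstrassCurve ℚ)
      [W.IsElliptic] [W.IsGloballyMinimal] (C : VariableChange ℚ) (p : ℕ) [Fact p.Prime],
      5 ≤ p → C • W.quadraticTwist ((-1) ^ (p / 2) * p) = V → V.HasGoodReductionAtPrime p →
      V.frobeniusTrace p = 0 → (∀ m : ℕ, V.HasSurjectiveModNGaloisRep (p ^ m : ℕ)) →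
      ¬ p ∣ W.tamagawaProduct →
      ∀ {NW : ℕ} [NeZero NW] (D : ModularParametrizationData W NW),
        ∃ (n : ℕ) (_ : NeZero n), Kato.IsKolyvaginProduct W p 1 n ∧
          (∀ (ℓ : ℕ) [Fact ℓ.Prime], ℓ ∣ n →
            Nat.card {P : ((WeierstrassCurve.integralModelInt W).map
              (Int.castRingHom (ZMod ℓ))).toAffine.Point // p • P = 0} ≤ p) ∧
          ∃ ψ : (ℓ : ℕ) → (ZMod ℓ)ˣ →* Multiplicative (ZMod p),
            (∀ ℓ ∈ n.primeFactors, Function.Surjective (ψ ℓ)) ∧ kuriharaNumber D.f p n ψ ≠ 0)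
    (hTam : ∀ (V : WeierstrassCurve ℚ) [V.IsElliptic] [V.IsGloballyMinimal] (W : WeierstrassCurve ℚ)
      [W.IsElliptic] [W.IsGloballyMinimal] (C : VariableChange ℚ) (p : ℕ) [Fact p.Prime],
      5 ≤ p → C • W.quadraticTwist ((-1) ^ (p / 2) * p) = V → V.HasGoodReductionAtPrime p →
      V.frobeniusTrace p = 0 → (∀ m : ℕ, V.HasSurjectiveModNGaloisRep (p ^ m : ℕ)) →
      p ∣ W.tamagawaProduct → QuadraticBranchPlusEtaLowerInclusionAt V p) :
    PlusEtaLowerInclusion := by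
  refine plusEtaLowerInclusion_of_kim111_of_kuriharaData_of_tamagawaRows hKim ?_ hTam
  intro V _ _ W _ _ C p _ h5 hCV hgood hap htower htam
  obtain ⟨NW, _, D, hc, hper⟩ := hManin V W C p h5 hCV hgood hap htower
  obtain ⟨n, _, hn, hcyc, ψ, hψ, hδ⟩ := hKur V W C p h5 hCV hgood hap htower htam D
  exact ⟨NW, inferInstance, D, hc, hper, n, inferInstance, hn, hcyc, ψ, hψ, hδ⟩

/-! ## §4 The Tamagawa-free sub-locus per `V`: (E⁺_η) and (C1⁺_η) from (K1) + (K2) alone -/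

/-- **(E⁺_η) ∧ (C1⁺_η) on the Tamagawa-free tower-onto sub-locus, per `V`, with NO partner in the
statement.** Under (K1) `hKim` and (K2) `hKur` of §2: for every globally minimal good supersingular
`a_p = 0` curve `V`, `p ≥ 5`, with onto `p`-adic tower, IF SOME globally minimal partner `W`
(`C • W^{(p*)} = V`) has `p ∤ ∏ c_ℓ(W)`, then the Eisenstein inclusion AND the full even main
conjecture at `η` hold at `(V, p)` (the road's second conjunct fires because the tower is onto).
CONDITIONAL; per-`V`; closes nothing; nothing booked.
[cite: Kim2022StructureSelmer, Thm. 1.11 (PDF p. 8), Conj. 1.9]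
[cite: Kobayashi2003, §4 Even main conjecture (p. 8)] -/
theorem etaPair_of_kim111_of_kuriharaData
    (hKim : Kim2026.thm111_etaEisensteinInclusion_of_kuriharaNumber_ne_zero)
    (hKur : ∀ (V : WeierstrassCurve ℚ) [V.IsElliptic] [V.IsGloballyMinimal] (W : WeierstrassCurve ℚ)
      [W.IsElliptic] [W.IsGloballyMinimal] (C : VariableChange ℚ) (p : ℕ) [Fact p.Prime],
      5 ≤ p → C • W.quadraticTwist ((-1) ^ (p / 2) * p) = V → V.HasGoodReductionAtPrime p →
      V.frobeniusTrace p = 0 → (∀ m : ℕ, V.HasSurjectiveModNGaloisRep (p ^ m : ℕ)) →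
      ¬ p ∣ W.tamagawaProduct →
      ∃ (NW : ℕ) (_ : NeZero NW) (D : ModularParametrizationData W NW),
        ¬ (p : ℤ) ∣ D.maninConstant ∧
        (∃ u : ℚ, ‖(u : ℚ_[p])‖ = 1 ∧ W.realPeriodRat = u * plusPeriod D.f) ∧
        ∃ (n : ℕ) (_ : NeZero n), Kato.IsKolyvaginProduct W p 1 n ∧
          (∀ (ℓ : ℕ) [Fact ℓ.Prime], ℓ ∣ n →
            Nat.card {P : ((WeierstrassCurve.integralModelInt W).map
              (Int.castRingHom (ZMod ℓ))).toAffine.Point // p • P = 0} ≤ p) ∧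
          ∃ ψ : (ℓ : ℕ) → (ZMod ℓ)ˣ →* Multiplicative (ZMod p),
            (∀ ℓ ∈ n.primeFactors, Function.Surjective (ψ ℓ)) ∧ kuriharaNumber D.f p n ψ ≠ 0)
    (V : WeierstrassCurve ℚ) [V.IsElliptic] [V.IsGloballyMinimal] (p : ℕ) [Fact p.Prime]
    (h5 : 5 ≤ p) (hgood : V.HasGoodReductionAtPrime p) (hap : V.frobeniusTrace p = 0)
    (htower : ∀ m : ℕ, V.HasSurjectiveModNGaloisRep (p ^ m : ℕ))
    (W : WeierstrassCurve ℚ) [W.IsElliptic] [W.IsGloballyMinimal] (C : VariableChange ℚ)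
    (hCV : C • W.quadraticTwist ((-1) ^ (p / 2) * p) = V) (htam : ¬ p ∣ W.tamagawaProduct) :
    QuadraticBranchPlusEtaLowerInclusionAt V p ∧ QuadraticBranchPlusEtaMainConjectureAt V p := by
  have hd : ((-1 : ℚ) ^ (p / 2) * p) ≠ 0 :=
    mul_ne_zero (pow_ne_zero _ (by norm_num)) (by exact_mod_cast (Fact.out : p.Prime).ne_zero)
  obtain ⟨C', hC'⟩ := exists_variableChange_twist_of_model_twist W hd hCV
  have hsurj : W.HasSurjectiveModNGaloisRep p := by
    simpa only [pow_one] using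
      (GaloisImage.hasSurjectiveModNGaloisRep_pow_iff_of_model_twist V p hd ⟨C', hC'⟩ 1).mpr (htower 1)
  obtain ⟨NW, _, D, hc, hper, n, _, hn, hcyc, ψ, hψ, hδ⟩ :=
    hKur V W C p h5 hCV hgood hap htower htam
  have h := PlusEtaKuriharaT0.etaPair_of_thm111_of_kuriharaUnit hKim W C hCV h5 hsurj htam D hc hper
    n hn hcyc ψ hψ hδ
  exact ⟨h.1, h.2 htower⟩

end Summit.BirchSwinnertonDyer.BirchSwinnertonDyer.Theorems.PlusEtaKuriharaCut

end
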